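import Literature.Analysis.SpecialFunctions.RiemannThetaLefschetzTypeD
import Literature.Geometry.Kaehler.SiegelTorusThetaEmbedding
import HarnessLib

/-!
# Lefschetz's theorem for complex tori of polarisation type `D`: the theta embedding of `ℂⁿ/(Dℤⁿ ⊕ Ωℤⁿ)`

Let `Ω` be a point of the Siegel upper half space `𝔥ₙ` (`Ω` symmetric, `Im Ω` positive definite),
`D = diag(d₁, …, dₙ)` with positive integers `dᵢ`, and `X = ℂⁿ/(Dℤⁿ ⊕ Ωℤⁿ)` the complex torus
they define — the normal form of a complex torus with a Riemann form (polarisation) of type `D`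
(Lange–Birkenhake, *Complex Abelian Varieties*, §3.1 and §8.1: period matrix `(Z, D)`), presented
as the tree's `ComplexTorus Φ` for the period isomorphism `Φ : ℝⁿ ⊕ ℝⁿ ≃ ℂⁿ`,
`(x, y) ↦ Dx + Ωy`. **Lefschetz's theorem** (Lange–Birkenhake Thm. 4.5.1: "`Lⁿ` is very ample for
any `n ≥ 3`" and every positive line bundle `L`; Mumford, *Abelian Varieties* §3; Griffiths–Harris
Ch. 2 §6): the `3ⁿ·d₁⋯dₙ` theta functions of level three and type `D`
(`Literature.Analysis.SpecialFunctions.exists_lefschetz_levelThree_family_typeD_of_posDef`) define a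
map `F : X → ℙᴺ(ℂ)` which is **holomorphic, injective, and an immersion**.

* `ComplexTorus.exists_embedding_of_lefschetzFamily` — the lattice-free packaging: for ANY complex
  torus `ComplexTorus Φ` (`Φ : ℝ^ι ≃ ℂⁿ`) and any finite family of entire functions on `ℂⁿ` which is
  automorphic for the lattice `Φ(ℤ^ι)` with a common factor, has no common zero, separates points
  modulo the lattice and separates tangent vectors, `π(z) ↦ [f_k(z)]_k` is an injective holomorphic
  immersion `ComplexTorus Φ → ℙᴺ(ℂ)` (the manifold half of the proof of
  `siegelTorus_thetaEmbedding`, verbatim, with the lattice abstracted);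
* `siegelTorus_thetaEmbedding_typeD` — **the theorem** for `ℂⁿ/(Dℤⁿ ⊕ Ωℤⁿ)`, in the typing of
  `siegelTorus_thetaEmbedding` (the case `D = 1`):
  `∃ N F, ContMDiff 𝓘(ℂ, ℂⁿ) 𝓘(ℂ, ℂ^N) ω F ∧ Injective F ∧ ∀ x, Injective (mfderiv F x)`.

Everything is proved; no definitions, no named facts.

## References

* [LangeBirkenhake1992] H. Lange, Ch. Birkenhake, Complex Abelian Varieties (1992), §3.1, Thm. 4.5.1,
  §8.1, Lemma 1.1.3.
* [MumfordAV1970] D. Mumford, Abelian Varieties (1970), §3 (Theorem of Lefschetz).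
* [GriffithsHarris1978] P. Griffiths, J. Harris, Principles of Algebraic Geometry (1978), Ch. 2 §6.
* [MumfordTata1] D. Mumford, Tata Lectures on Theta I (1983), Ch. II §1, Thm. 1.3.
-/

noncomputable section

open scoped Manifold ContDiff Topology LinearAlgebra.Projectivization Real
open Set Filter Complex
open Literature.Analysis.SpecialFunctions Literature.Analysis.Complex

namespace Literature.Geometry.Kaehler

/-! ### From a Lefschetz family to a projective embedding of the torus -/

section LefschetzFamily

variable {ι : Type} [Fintype ι] {n : ℕ}

/-- **A Lefschetz family embeds the torus.** Let `X = ℂⁿ/Φ(ℤ^ι)` be a complex torus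
(`ComplexTorus Φ`) and `(f_k)_{k ∈ K}` a finite family of entire functions on `ℂⁿ` such that
(i) for every lattice vector `λ = Φ(v)` there is a factor `e` with `f_k(z + λ) = e · f_k(z)` for ALL
`k` (a common factor of automorphy), (ii) the `f_k` have no common zero, (iii) `f_k(z₂) = γ f_k(z₁)`
for all `k` forces `z₂ - z₁ ∈ Φ(ℤ^ι)`, and (iv) `∂_u f_k(z) = μ f_k(z)` for all `k` forces `u = 0`.
Then `π(z) ↦ [f_k(z)]_k` is a well-defined map `F : X → ℙᴺ(ℂ)` (`N + 1 = #K`) which is holomorphic,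
injective and an immersion. This is the manifold half of the classical proof of Lefschetz's theorem
(Griffiths–Harris Ch. 2 §6; Mumford AV §3), for an arbitrary lattice. [cite: GriffithsHarris1978, Ch. 2 §6 (The Lefschetz theorem)]
[cite: LangeBirkenhake1992, Thm. 4.5.1] -/
theorem ComplexTorus.exists_embedding_of_lefschetzFamily (Φ : (ι → ℝ) ≃L[ℝ] (Fin n → ℂ))
    {K : Type} [Fintype K] (f : K → (Fin n → ℂ) → ℂ) (hdiff : ∀ k, Differentiable ℂ (f k))
    (hlat : ∀ (z : Fin n → ℂ) (v : ι → ℤ), ∃ e : ℂ, ∀ k,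
      f k (z + ComplexTorus.latticeVec Φ v) = e * f k z)
    (hbpf : ∀ z : Fin n → ℂ, ∃ k, f k z ≠ 0)
    (hinj : ∀ (z₁ z₂ : Fin n → ℂ) (γ : ℂ), (∀ k, f k z₂ = γ * f k z₁) →
      ∃ v : ι → ℤ, z₂ = z₁ + ComplexTorus.latticeVec Φ v)
    (himm : ∀ (z u : Fin n → ℂ) (μ : ℂ), (∀ k, fderiv ℂ (f k) z u = μ * f k z) → u = 0) :
    ∃ (N : ℕ) (F : ComplexTorus Φ → ℙ ℂ (Fin (N + 1) → ℂ)),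
      ContMDiff 𝓘(ℂ, Fin n → ℂ) 𝓘(ℂ, Fin N → ℂ) ω F ∧ Function.Injective F ∧
        ∀ x, Function.Injective (mfderiv 𝓘(ℂ, Fin n → ℂ) 𝓘(ℂ, Fin N → ℂ) F x) := by
  -- enumerate the indices by `Fin (N + 1)`, `N + 1 = #K` (`K` is non-empty by (ii))
  have hKpos : 0 < Fintype.card K := by
    obtain ⟨k, -⟩ := hbpf 0
    exact Fintype.card_pos_iff.mpr ⟨k⟩
  have hcard : Fintype.card K = (Fintype.card K - 1) + 1 := by omega
  set N : ℕ := Fintype.card K - 1 with hN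
  set σ : Fin (N + 1) ≃ K := (Fintype.equivFinOfCardEq hcard).symm with hσ
  -- homogeneous coordinates
  set gv : (Fin n → ℂ) → Fin (N + 1) → ℂ := fun z k => f (σ k) z with hgv
  have hgv0 : ∀ z, gv z ≠ 0 := by
    intro z h0
    obtain ⟨k, hk⟩ := hbpf z
    have := congrFun h0 (σ.symm k)
    simp only [hgv, Equiv.apply_symm_apply, Pi.zero_apply] at this
    exact hk this
  have hgvc : Continuous gv := continuous_pi fun k => (hdiff (σ k)).continuous
  have hgvd : ∀ z k, DifferentiableAt ℂ (fun y => gv y k) z := fun z k => hdiff (σ k) z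
  have hgva : ∀ z k, ContDiffAt ℂ ω (fun y => gv y k) z := fun z k =>
    (ThetaRigidity.analyticOnNhd_univ (hdiff (σ k)) z (mem_univ z)).contDiffAt
  set G : (Fin n → ℂ) → ℙ ℂ (Fin (N + 1) → ℂ) := fun z => Projectivization.mk ℂ (gv z) (hgv0 z)
    with hG
  -- lattice invariance of `G`
  have hGper : ∀ (z : Fin n → ℂ) (v : ι → ℤ), G (z + ComplexTorus.latticeVec Φ v) = G z := by
    intro z v
    obtain ⟨e, he⟩ := hlat z v
    have hcoord : ∀ k, gv (z + ComplexTorus.latticeVec Φ v) k = e * gv z k := fun k => he (σ k)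
    have he0 : e ≠ 0 := by
      obtain ⟨k, hk⟩ := hbpf (z + ComplexTorus.latticeVec Φ v)
      intro h0
      apply hk
      have := hcoord (σ.symm k)
      simp only [hgv, Equiv.apply_symm_apply] at this
      rw [this, h0, zero_mul]
    simp only [hG]
    rw [Projectivization.mk_eq_mk_iff']
    exact ⟨e, funext fun k => by rw [Pi.smul_apply, smul_eq_mul, hcoord k]⟩
  have hGper' : ∀ (z : Fin n → ℂ) (v : ι → ℤ), G (z - ComplexTorus.latticeVec Φ v) = G z := by
    intro z v
    have := hGper (z - ComplexTorus.latticeVec Φ v) v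
    rw [sub_add_cancel] at this
    exact this.symm
  -- smoothness of `G`
  have hGsmooth : ContMDiff 𝓘(ℂ, Fin n → ℂ) 𝓘(ℂ, Fin N → ℂ) ω G := fun z =>
    contMDiffAt_projectivizationMk hgv0 hgvc (hgva z)
  -- the map on the torus
  set F : ComplexTorus Φ → ℙ ℂ (Fin (N + 1) → ℂ) := fun t =>
    G (extChartAt 𝓘(ℂ, Fin n → ℂ) t t) with hF
  have hFcover : ∀ z, F (ComplexTorus.cover Φ z) = G z := by
    intro z
    simp only [hF]
    rw [ComplexTorus.extChartAt_cover_self]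
    exact hGper' z _
  have hFsmooth : ContMDiff 𝓘(ℂ, Fin n → ℂ) 𝓘(ℂ, Fin N → ℂ) ω F := by
    intro t
    have hev : F =ᶠ[𝓝 t] G ∘ extChartAt 𝓘(ℂ, Fin n → ℂ) t := by
      filter_upwards [extChartAt_source_mem_nhds (I := 𝓘(ℂ, Fin n → ℂ)) t] with t' ht'
      have e : t' = ComplexTorus.cover Φ (extChartAt 𝓘(ℂ, Fin n → ℂ) t t') := by
        rw [← ComplexTorus.extChartAt_symm_eq_cover Φ (𝕜 := ℂ) t]
        exact ((extChartAt 𝓘(ℂ, Fin n → ℂ) t).left_inv ht').symm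
      calc F t' = F (ComplexTorus.cover Φ (extChartAt 𝓘(ℂ, Fin n → ℂ) t t')) := by rw [← e]
        _ = G (extChartAt 𝓘(ℂ, Fin n → ℂ) t t') := hFcover _
    exact ((hGsmooth _).comp t contMDiffAt_extChartAt).congr_of_eventuallyEq hev
  refine ⟨N, F, hFsmooth, ?_, ?_⟩
  · -- injectivity
    intro t₁ t₂ h
    obtain ⟨z₁, rfl⟩ := ComplexTorus.cover_surjective Φ t₁
    obtain ⟨z₂, rfl⟩ := ComplexTorus.cover_surjective Φ t₂
    rw [hFcover, hFcover] at h
    simp only [hG] at h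
    rw [Projectivization.mk_eq_mk_iff'] at h
    obtain ⟨a, ha⟩ := h
    have hprop : ∀ k, f k z₁ = a * f k z₂ := by
      intro k
      have := congrFun ha (σ.symm k)
      simp only [hgv, Pi.smul_apply, smul_eq_mul, Equiv.apply_symm_apply] at this
      exact this.symm
    obtain ⟨v, hv⟩ := hinj z₂ z₁ a hprop
    rw [hv, ComplexTorus.cover_add_latticeVec]
  · -- immersion
    intro t
    obtain ⟨z, rfl⟩ := ComplexTorus.cover_surjective Φ t
    have hFmd : MDifferentiableAt 𝓘(ℂ, Fin n → ℂ) 𝓘(ℂ, Fin N → ℂ) F (ComplexTorus.cover Φ z) :=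
      (hFsmooth _).mdifferentiableAt (by simp)
    have hchain := mfderiv_comp z hFmd (ComplexTorus.mdifferentiable_cover Φ (𝕜 := ℂ) z)
    rw [ComplexTorus.mfderiv_cover, show F ∘ ComplexTorus.cover Φ = G from funext hFcover] at hchain
    refine (injective_iff_map_eq_zero _).mpr fun u hu => ?_
    have hu' : mfderiv 𝓘(ℂ, Fin n → ℂ) 𝓘(ℂ, Fin N → ℂ) G z u = 0 := by
      rw [hchain]
      exact hu
    obtain ⟨μ, hμ⟩ := exists_eq_mul_of_mfderiv_projectivizationMk_eq_zero hgv0 hgvc (hgvd z) hu'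
    refine himm z u μ fun k => ?_
    have := hμ (σ.symm k)
    simpa only [hgv, Equiv.apply_symm_apply] using this

end LefschetzFamily

/-! ### The theta embedding of the torus `ℂⁿ/(Dℤⁿ ⊕ Ωℤⁿ)` -/

section ThetaEmbeddingTypeD

variable {n : ℕ}

/-- The lattice of `ComplexTorus Φ` for the period isomorphism `(x, y) ↦ Dx + Ωy` is `Dℤⁿ ⊕ Ωℤⁿ`:
`Φ(v) = (dᵢ v₁ᵢ + Σⱼ Ωᵢⱼ v₂ⱼ)ᵢ` for `v ∈ ℤ²ⁿ`. [cite: LangeBirkenhake1992, §8.1] -/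
theorem latticeVec_siegel_typeD (Ω : Matrix (Fin n) (Fin n) ℂ) (d : Fin n → ℕ)
    (Φ : (Fin n ⊕ Fin n → ℝ) ≃L[ℝ] (Fin n → ℂ))
    (hΦ : ∀ v i, Φ v i = (d i : ℂ) * (v (Sum.inl i) : ℂ) + ∑ j, Ω i j * (v (Sum.inr j) : ℂ))
    (v : Fin n ⊕ Fin n → ℤ) (i : Fin n) :
    ComplexTorus.latticeVec Φ v i =
      (d i : ℂ) * ((v (Sum.inl i) : ℤ) : ℂ) + ∑ j, Ω i j * ((v (Sum.inr j) : ℤ) : ℂ) := by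
  rw [ComplexTorus.latticeVec, hΦ]
  simp only [Complex.ofReal_intCast]

/-- **Lefschetz's theorem for the torus `ℂⁿ/(Dℤⁿ ⊕ Ωℤⁿ)` of polarisation type `D`** (`Ω` symmetric
with positive definite imaginary part, `D = diag(d₁, …, dₙ)` with `dᵢ ≥ 1`), in the typing of
`siegelTorus_thetaEmbedding` (the principal case `D = 1`): there are `N` (`= 3ⁿd₁⋯dₙ - 1`) and a map
`F : ComplexTorus Φ → ℙᴺ(ℂ)` — the theta map of level three and type `D`,
`π(z) ↦ [e^{2πi ᵗk D⁻¹ z} ϑ(3z + ΩD⁻¹k, 3Ω)]_k` — which is holomorphic, injective, and has injective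
differential everywhere. Hence every complex torus with a Riemann form of type `D` (period matrix
`(D, Ω)` in a symplectic basis, Lange–Birkenhake §3.1, §8.1) embeds in projective space.
[cite: LangeBirkenhake1992, Thm. 4.5.1] [cite: MumfordAV1970, §3 (Theorem of Lefschetz)]
[cite: GriffithsHarris1978, Ch. 2 §6 (The Lefschetz theorem)] -/
theorem siegelTorus_thetaEmbedding_typeD (Ω : Matrix (Fin n) (Fin n) ℂ) (hΩ : ∀ i j, Ω i j = Ω j i)
    (hpos : (Matrix.of fun i j => (Ω i j).im).PosDef) (d : Fin n → ℕ) (hd : ∀ i, 0 < d i)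
    (Φ : (Fin n ⊕ Fin n → ℝ) ≃L[ℝ] (Fin n → ℂ))
    (hΦ : ∀ v i, Φ v i = (d i : ℂ) * (v (Sum.inl i) : ℂ) + ∑ j, Ω i j * (v (Sum.inr j) : ℂ)) :
    ∃ (N : ℕ) (F : ComplexTorus Φ → ℙ ℂ (Fin (N + 1) → ℂ)),
      ContMDiff 𝓘(ℂ, Fin n → ℂ) 𝓘(ℂ, Fin N → ℂ) ω F ∧ Function.Injective F ∧
        ∀ x, Function.Injective (mfderiv 𝓘(ℂ, Fin n → ℂ) 𝓘(ℂ, Fin N → ℂ) F x) := by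
  obtain ⟨f, hdiff, hper, hqper, hbpf, hinj, himm⟩ :=
    exists_lefschetz_levelThree_family_typeD_of_posDef Ω hΩ hpos d hd
  refine ComplexTorus.exists_embedding_of_lefschetzFamily Φ f hdiff ?_ hbpf ?_ himm
  · -- common factor of automorphy along `Dℤⁿ ⊕ Ωℤⁿ`
    intro z v
    set m : Fin n → ℤ := fun i => v (Sum.inl i) with hm
    set n' : Fin n → ℤ := fun j => v (Sum.inr j) with hn'
    have hz : z + ComplexTorus.latticeVec Φ v =
        fun i => (fun i => z i + ∑ j, Ω i j * (n' j : ℂ)) i + (d i : ℂ) * (m i : ℂ) := by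
      funext i
      rw [Pi.add_apply, latticeVec_siegel_typeD Ω d Φ hΦ v i]
      simp only [hm, hn']
      ring
    refine ⟨cexp (3 * (-(π * I * ∑ i, ∑ j, (n' i : ℂ) * Ω i j * (n' j : ℂ)) -
      2 * π * I * ∑ i, (n' i : ℂ) * z i)), fun k => ?_⟩
    rw [hz, hper, hqper]
  · -- separation of points modulo `Dℤⁿ ⊕ Ωℤⁿ`
    intro z₁ z₂ γ hγ
    obtain ⟨m, n', hmn⟩ := hinj z₁ z₂ γ hγ
    refine ⟨Sum.elim m n', funext fun i => ?_⟩
    rw [Pi.add_apply, latticeVec_siegel_typeD Ω d Φ hΦ]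
    simp only [Sum.elim_inl, Sum.elim_inr]
    have := hmn i
    linear_combination this

end ThetaEmbeddingTypeD

end Literature.Geometry.Kaehler

end
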